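import Mathlib
import Summits.ResolutionOfSingularities.ResolutionOfSingularities.Theorems.WeightedInvariantLocalWeightedDropWildMonicKangarooShiftForms
import Summits.ResolutionOfSingularities.ResolutionOfSingularities.Theorems.WeightedInvariantLocalWeightedDropWildMonicFlagNnDefs

/-!
# `WeightedInvariant.LocalWeightedDrop`, line `hasse-ridge-face-selection`, S3ρ sub-stub S3ρD₂ / S3ρ flag line (Uk-ρD3 `DropAxisKangaroo`):
# BRIDGE — `dStar` is stub-5's `initHeight`, `wMin` is `wOrdN`, on the scaled Newton set

Crux item stmt-ResolutionOfSingularities-8899 `LocalWeightedDrop` (route `ResolutionOfSingularities/WeightedInvariant`), engine of the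
door `HypersurfaceCentreConstruction` stmt-ResolutionOfSingularities-19897.  [OURS · L1 W4.3, chain w43, seat res-type-056 ((C8) D-d KANGAROO →
Uk-ρD3).  MODEL: S. Perlega, arXiv:2011.14443 [cite: Perlega2020, Ch. 2 §2 Lemma 2.2.1 «`ỹ(J) = (w₁(J), w₂(minit_{w₁}(J)))`»; Ch. 4 Prop. 4.1.5
«`m_{𝓕,x} = w_n(J_{2,x})`, `d_{𝓕,x} = ord_{(y)} minit_{w_n}(J_{2,x})`»].  Nothing here is a statement of H. Hironaka's manuscript
[claim: Hironaka2017, status: under-review]; OUR bookkeeping between two OUR vocabularies.]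

For the weight `w = (1, n)` (`w 0 = 1`, `w 1 = n`; letters `x = 0`, flag letter `y = 1`) and a tuple `B` with `wMin w B = m < ⊤`:
* `wOrdN_newtonSet_eq_of_wMin_eq` — stub-5's `wOrdN n (newtonSet B)` (…WildMonicFlagNnDefs, p506745) is `m`;
* `initPts_eq_oneN` — `initPts w N` (…WildMonicKangarooDefs) is the `(1,n)`-initial line `{P ∈ N | P₀ + n P₁ = wOrdN n N}`;
* `mem_initPts_newtonSet_iff` — the initial Newton points are exactly the scaled initial exponents of the ATTAINING slots;
* `initHeight_newtonSet_eq_dStar` — stub-5's `initHeight n (newtonSet B)` (`d_{𝓕,x}`) is `dStar 1 w B` (Perlega's `ord_{(y)} minit_w(J₂)` read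
  slot by slot: the least `y`-exponent on the initial line is the least `s_j · ord_{(y)} in_w(B_j)` over the attaining slots).
So the kangaroo bound of `…WildMonicKangarooBound` / `…KangarooShearBound` is a bound on `initHeight`, hence on `dFlagN`.
AI-written; gate-accepted means sorry-free with standard axioms, not refereed.
-/

set_option linter.dupNamespace false -- mandated namespace of this single-conjunct summit

noncomputable section

namespace Summit.ResolutionOfSingularities.ResolutionOfSingularities.Theorems

namespace WildMonic

open MvPowerSeries MonicDescent

variable {k : Type} [Field k] {w : Fin 2 → ℕ} {n : ℕ} (hw0 : w 0 = 1) (hw1 : w 1 = n)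

include hw0 hw1 in
/-- The weight `(1, n)` as a function on points. -/
theorem weight_coe_eq_oneN : (Finsupp.weight w : (Fin 2 →₀ ℕ) → ℕ) = fun P => P 0 + n * P 1 :=
  funext fun P => by rw [weight_fin_two, hw0, hw1, one_mul]

include hw0 hw1 in
/-- `initPts` for the weight `(1,n)` is the `(1,n)`-initial line of stub-5. -/
theorem initPts_eq_oneN (N : Set (Fin 2 →₀ ℕ)) : initPts w N = {P : Fin 2 →₀ ℕ | P ∈ N ∧ P 0 + n * P 1 = wOrdN n N} := by
  ext P
  rw [mem_initPts_iff, weight_coe_eq_oneN hw0 hw1, wOrdN_def]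
  rfl

variable {d : ℕ} (B : Fin d → MvPowerSeries (Fin 2) k)

include hw0 hw1 in
/-- `wOrdN n (newtonSet B) = m = wMin w B` (finite case). -/
theorem wOrdN_newtonSet_eq_of_wMin_eq {m : ℕ} (hm : wMin w B = m) : wOrdN n (newtonSet B) = m := by
  rw [wOrdN_def, ← weight_coe_eq_oneN hw0 hw1]; exact sInf_weight_newtonSet w B hm

/-- THE INITIAL NEWTON POINTS ARE THE SCALED INITIAL EXPONENTS OF THE ATTAINING SLOTS (converse of `smul_mem_initPts_newtonSet`). -/
theorem mem_initPts_newtonSet_iff (w : Fin 2 → ℕ) {m : ℕ} (hm : wMin w B = m) (P : Fin 2 →₀ ℕ) :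
    P ∈ initPts w (newtonSet B) ↔
      ∃ (j : Fin d) (e : Fin 2 →₀ ℕ), slotWOrd w B j = wMin w B ∧ e ∈ initSupp w (B j) ∧ P = slotWeight d j • e := by
  constructor
  · rintro ⟨⟨j, e, he, rfl⟩, hPw⟩
    rw [sInf_weight_newtonSet w B hm] at hPw
    -- `s_j · weight e = m ≤ s_j · ord_w(B_j) ≤ s_j · weight e`
    have h1 : slotWOrd w B j ≤ ((Finsupp.weight w (slotWeight d j • e) : ℕ) : ℕ∞) := slotWOrd_le_weight_smul w B he
    have h2 : (m : ℕ∞) ≤ slotWOrd w B j := by rw [← hm]; exact wMin_le_slotWOrd w B j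
    have hsm : (slotWeight d j : ℕ∞) * ((Finsupp.weight w e : ℕ) : ℕ∞) = m := by rw [← Nat.cast_mul, ← weight_smul, hPw]
    rw [hPw] at h1
    have hjm' : slotWOrd w B j = m := le_antisymm h1 h2
    have hjm : slotWOrd w B j = wMin w B := by rw [hm]; exact hjm'
    refine ⟨j, e, hjm, ⟨he, ?_⟩, rfl⟩
    -- `weight e = ord_w (B j)`: cancel the slot weight in `s_j · weight e = s_j · ord`
    have h3 : (slotWeight d j : ℕ∞) * ((Finsupp.weight w e : ℕ) : ℕ∞) = (slotWeight d j : ℕ∞) * (B j).weightedOrder w := by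
      rw [hsm, ← hjm']; rfl
    exact (ENat.mul_le_mul_left_iff (by exact_mod_cast (slotWeight_pos j).ne') (ENat.coe_ne_top _)).mp h3.le |>.antisymm
      ((ENat.mul_le_mul_left_iff (by exact_mod_cast (slotWeight_pos j).ne') (ENat.coe_ne_top _)).mp h3.ge)
  · rintro ⟨j, e, hj, he, rfl⟩
    exact smul_mem_initPts_newtonSet w B hm hj he

/-- The `y`-adic order of an initial form is bounded by the `y`-exponent of any of its monomials. -/
theorem yOrd_inW_le_of_mem_initSupp {w : Fin 2 → ℕ} {F : MvPowerSeries (Fin 2) k} {e : Fin 2 →₀ ℕ} (he : e ∈ initSupp w F) :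
    (inW w F).weightedOrder (Pi.single 1 1) ≤ (e 1 : ℕ) := by
  have h := weightedOrder_le (Pi.single 1 1 : Fin 2 → ℕ) ((coeff_inW_ne_zero_iff w F e).mpr he)
  rwa [weight_single_one (show (0 : Fin 2) ≠ 1 by decide)] at h

/-- The `y`-adic order of a non-zero initial form is attained at an initial exponent. -/
theorem exists_initSupp_yOrd_eq (w : Fin 2 → ℕ) {F : MvPowerSeries (Fin 2) k} (hF : F ≠ 0) :
    ∃ e ∈ initSupp w F, (inW w F).weightedOrder (Pi.single 1 1) = (e 1 : ℕ) := by
  have h0 : inW w F ≠ 0 := inW_ne_zero w hF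
  have hfin : ((inW w F).weightedOrder (Pi.single 1 1)).toNat = (inW w F).weightedOrder (Pi.single 1 1) :=
    ENat.coe_toNat ((weightedOrder_eq_top_iff _).not.mpr h0)
  obtain ⟨e, he, hew⟩ := exists_coeff_ne_zero_and_weightedOrder _ hfin
  refine ⟨e, (coeff_inW_ne_zero_iff w F e).mp he, ?_⟩
  rw [← hew, weight_single_one (show (0 : Fin 2) ≠ 1 by decide)]

include hw0 hw1 in
/-- `d_{𝓕,x}` IS `d_*`: stub-5's least height on the `(1,n)`-initial line of the scaled Newton set equals `dStar 1 w B` (finite `m`). -/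
theorem initHeight_newtonSet_eq_dStar {m : ℕ} (hm : wMin w B = m) : (initHeight n (newtonSet B) : ℕ∞) = dStar 1 w B := by
  have hm' : wMin w B ≠ ⊤ := by rw [hm]; exact ENat.coe_ne_top m
  have hline : ∀ P : Fin 2 →₀ ℕ, P ∈ initPts w (newtonSet B) ↔ P ∈ newtonSet B ∧ P 0 + n * P 1 = wOrdN n (newtonSet B) := fun P => by
    rw [initPts_eq_oneN hw0 hw1]; rfl
  apply le_antisymm
  · -- `initHeight ≤ s_j · ord_y in_w(B_j)` for every attaining slot
    refine le_dStar 1 w B fun j hj => ?_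
    obtain ⟨hBj, -, -, -⟩ := exists_weightedOrder_eq_of_attains w B hj hm'
    obtain ⟨e, he, hye⟩ := exists_initSupp_yOrd_eq w hBj
    have hP := (hline _).mp (smul_mem_initPts_newtonSet w B hm hj he)
    have h := initHeight_le n hP.1 hP.2
    rw [Finsupp.smul_apply, smul_eq_mul] at h
    rw [hye, ← Nat.cast_mul]
    exact_mod_cast h
  · -- the point realising `initHeight` comes from an attaining slot
    have hne : (newtonSet B).Nonempty := by
      obtain ⟨P, hP⟩ := initPts_newtonSet_nonempty w B hm
      exact ⟨P, hP.1⟩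
    obtain ⟨P, hP, hPw, hPh⟩ := exists_eq_initHeight n hne
    obtain ⟨j, e, hj, he, rfl⟩ := (mem_initPts_newtonSet_iff B w hm _).mp ((hline _).mpr ⟨hP, hPw⟩)
    rw [← hPh, Finsupp.smul_apply, smul_eq_mul, Nat.cast_mul]
    exact (dStar_le 1 w B hj).trans (by gcongr; exact yOrd_inW_le_of_mem_initSupp he)

include hw0 hw1 in
/-- … as natural numbers. -/
theorem initHeight_newtonSet_eq_toNat_dStar {m : ℕ} (hm : wMin w B = m) : initHeight n (newtonSet B) = (dStar 1 w B).toNat := by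
  rw [← initHeight_newtonSet_eq_dStar hw0 hw1 B hm, ENat.toNat_coe]

end WildMonic

end Summit.ResolutionOfSingularities.ResolutionOfSingularities.Theorems

end
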